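import Mathlib
import HarnessLib

/-!
# Route `LogConcaveChart` — BC5 rung for the deciding crux `UnitScaleChart` (δ = 0 level of the proxy floor)

Ideator seat ym-idea-8 g2, LINE 3 of rung R2a. The `δ = 0` (exact Gaussian chart) rung of the proxy-floor mechanism:
for a centred Gaussian on `ℝⁿ ⊕ ℝⁿ` (negative-time ⊕ positive-time chart coordinates) whose covariance `G` is symmetric,
REFLECTION-SYMMETRIC (`G (swap i) (swap j) = G i j`) and REFLECTION POSITIVE (mixed block `G₋₊ = toBlocks₁₂ G` positive
semidefinite), the Gaussian covariance proxy of the mirror pair of quadratic forms `(xᵀ H^ϑ x, xᵀ H⁺ x)`,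
`tr (G · diag(H,0) · G · diag(0,H)) = tr (G₋₊ H G₋₊ H) = ‖B H Bᵀ‖²_F ≥ 0` (`G₋₊ = Bᵀ B`),
is non-negative. This is the chart-level positivity that makes the proxy floor `rC ≥ 8ε` of `UnitScaleChart` attainable
in the free / lattice-Maxwell reference (where Yang–Mills' NT is silent); it exercises the route's lever (floors from the
Loewner/RP order on the chart side) and proves no summit, leg or spine crux.
-/

set_option autoImplicit false

namespace Summit.QuantumFields.YangMills.Cruxes.UnitScaleChart.Rung

open Matrix
open scoped ComplexOrder MatrixOrder

/-- Trace of a block matrix. -/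
theorem trace_fromBlocks' {n m : Type*} [Fintype n] [Fintype m] (A : Matrix n n ℝ) (B : Matrix n m ℝ)
    (C : Matrix m n ℝ) (D : Matrix m m ℝ) : (Matrix.fromBlocks A B C D).trace = A.trace + D.trace := by
  simp [Matrix.trace, Fintype.sum_sum_type]

/-- `tr (P H P H) ≥ 0` for `P` positive semidefinite and `H` symmetric (real matrices): `P = Bᵀ B` and
`tr (Bᵀ B H Bᵀ B H) = tr (M M) = tr (Mᵀ M) ≥ 0` with `M = B H Bᵀ` symmetric. -/
theorem trace_psd_mul_symm_mul_psd_mul_symm_nonneg {n : Type*} [Fintype n] [DecidableEq n] (P H : Matrix n n ℝ)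
    (hP : P.PosSemidef) (hH : H.IsSymm) : 0 ≤ (P * H * P * H).trace := by
  obtain ⟨B, hB⟩ := CStarAlgebra.nonneg_iff_eq_star_mul_self.mp hP.nonneg
  have hB' : P = Bᵀ * B := by
    rw [hB, Matrix.star_eq_conjTranspose, Matrix.conjTranspose_eq_transpose_of_trivial]
  set M : Matrix n n ℝ := B * H * Bᵀ with hMdef
  have hM : Mᵀ = M := by
    rw [hMdef, Matrix.transpose_mul, Matrix.transpose_mul, Matrix.transpose_transpose, hH.eq, Matrix.mul_assoc]
  have h1 : P * H * P * H = Bᵀ * (B * H * Bᵀ * B * H) := by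
    rw [hB']; simp only [Matrix.mul_assoc]
  have h2 : (B * H * Bᵀ * B * H) * Bᵀ = M * M := by
    simp only [hMdef, Matrix.mul_assoc]
  have hsq : (M * M).trace = (Mᵀ * M).trace := by rw [hM]
  rw [h1, Matrix.trace_mul_comm, h2, hsq]
  simp only [Matrix.trace, Matrix.diag, Matrix.mul_apply, Matrix.transpose_apply]
  exact Finset.sum_nonneg fun i _ => Finset.sum_nonneg fun j _ => mul_self_nonneg _

/-- **BC5 rung (δ = 0 level of the proxy floor of `UnitScaleChart`).** Reflection positivity of a reflection-symmetric
Gaussian covariance makes the mirror covariance proxy of a quadratic form non-negative: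
`0 ≤ tr (G · fromBlocks H 0 0 0 · G · fromBlocks 0 0 0 H)`. -/
theorem RpGaussianProxy :
    ∀ (n : ℕ) (G : Matrix (Fin n ⊕ Fin n) (Fin n ⊕ Fin n) ℝ) (H : Matrix (Fin n) (Fin n) ℝ),
      G.IsSymm → (∀ i j, G (Sum.swap i) (Sum.swap j) = G i j) → (Matrix.toBlocks₁₂ G).PosSemidef → H.IsSymm →
        0 ≤ (G * Matrix.fromBlocks H 0 0 0 * G * Matrix.fromBlocks 0 0 0 H).trace := by
  intro n G H hGs hswap hP hH
  have hQP : Matrix.toBlocks₂₁ G = Matrix.toBlocks₁₂ G := by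
    ext i j
    simp only [Matrix.toBlocks₂₁, Matrix.toBlocks₁₂, Matrix.of_apply]
    have := hswap (Sum.inl i) (Sum.inr j)
    simpa using this
  have key : (G * Matrix.fromBlocks H 0 0 0 * G * Matrix.fromBlocks 0 0 0 H).trace =
      (Matrix.toBlocks₂₁ G * H * Matrix.toBlocks₁₂ G * H).trace := by
    conv_lhs => rw [← Matrix.fromBlocks_toBlocks G]
    simp only [Matrix.fromBlocks_multiply, Matrix.mul_zero, Matrix.zero_mul, add_zero, zero_add,
      trace_fromBlocks', Matrix.trace_zero]
  rw [key, hQP]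
  exact trace_psd_mul_symm_mul_psd_mul_symm_nonneg _ _ hP hH

end Summit.QuantumFields.YangMills.Cruxes.UnitScaleChart.Rung
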